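import Summits.QuantumFields.YangMills.Theorems.FluctuationComparisonRegPrIntLWregFibredChart
import HarnessLib

/-!
# PORT F2b — CHART-REG II (§0h of `Lines/wreg_chart.lean` v20, VERBATIM): the regular fibred chart of `Ū⁽ⁿ⁾`

Cell `ym3-torus` (HUMAN RULING D-0037 — YM₃ on T³ is ladder rung R3, not the Clay problem), width seat `ym3-torus-px11` g8; count-neutral helper
(`--kind proof --supports stmt-QuantumFields-20520 --as helper`).  A PORT IS BOOKKEEPING: every declaration below is a VERBATIM move of a declaration PROVED in the
Cruxes workfile `Cruxes/FluctuationComparisonRegPrIntL/Lines/wreg_chart.lean` v20 (ideator ym-r3-idea-1 g18, LINE g18-2; 116 decls, 0 `sorry`), per the PORT MAP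
`Lines/wreg_chart_port.md` (its file F2, split at the section seams to respect the 400-line rule), so that the organ WREG becomes importable BY NAME.
Nothing new is proved; WREG is one organ of S2β; EXW ∕ GAP ∕ LAPLACE ∕ H4ᶜ ∕ LFR♯ᶜ and the package's stubs are untouched; crux stmt-QuantumFields-20520 is
NOT closed; no summit statement is proved; rung R3 = YM₃ on T³ (SU(2)) — NOT d = 4, NOT infinite volume, NOT a mass gap, NOT Clay.
References: T. Bałaban, CMP 109 (1987) 249–301 [Balaban1987RG1] ((0.4) p.253, (2.9)–(2.10) pp.266–267); A. S. Kechris, Classical Descriptive Set Theory (1995) [Kechris1995].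

THIS FILE (F2b) = §0h CHART-REG II, fibre direction (v20 ll. 1379–1510, 1 decl): `exists_fibredChart_iter_reg` — the fibred chart of `Ū⁽ⁿ⁾` with its CLOSED
image windows, the chart-free window description `T_eq`, chartedness at raw-live points and recognition of charted fine fields exposed (closed-graph inverse
continuity via F1's `continuousOn_leftInverse_image`).  The only deviation from v20: the decl-local heartbeat-budget line is DROPPED (elaborates at the farm default and under a file-global 100 000 twin).  Same namespace as F2a.
-/

noncomputable section

open MeasureTheory Filter Topology Set
open scoped ENNReal NNReal
open Literature.MathematicalPhysics.QuantumFieldTheory.Balaban1983to89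
open Literature.MathematicalPhysics.QuantumFieldTheory.Balaban1983to89.T3ContinuumYM3Torus
open Literature.MathematicalPhysics.QuantumFieldTheory.Balaban1983to89.T3NestedUnitLaws
open Literature.MathematicalPhysics.QuantumFieldTheory.Balaban1983to89.T3UnitLawDensityEML
open Literature.MathematicalPhysics.QuantumFieldTheory.Balaban1983to89.T3UnitScaleTilt
open Literature.MathematicalPhysics.QuantumFieldTheory.Balaban1983to89.T3TiltDescent
open Literature.MathematicalPhysics.QuantumFieldTheory.Balaban1983to89.T3PrintedRegularMinimiser
open Literature.MathematicalPhysics.QuantumFieldTheory.Balaban1983to89.T3ConstrainedMinimiser (fibre)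
open Literature.MathematicalPhysics.QuantumFieldTheory.Balaban1983to89.T3LevelShift
open Literature.MathematicalPhysics.QuantumFieldTheory.Balaban1983to89.Missing
open Literature.MathematicalPhysics.QuantumFieldTheory.Balaban1983to89.T4Continuum
open scoped Literature.MathematicalPhysics.QuantumFieldTheory.Balaban1983to89.T3OrbitAverage

namespace Summit.QuantumFields.YangMills.Theorems.FluctuationComparisonRegPrIntLWregFibredChart

open Summit.QuantumFields.YangMills.Theorems.FluctuationComparisonRegPrIntLWregChain

section ChainLawSec

open Function
open Literature.MathematicalPhysics.QuantumFieldTheory.Balaban1983to89.BlockAveraging (Idx avgFun measurable_avgFun)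
open Literature.MathematicalPhysics.QuantumFieldTheory.Balaban1983to89.BlockAveragingHaarAC (centralBond centralBond_injective isLocal_avgFun pre post)
open Literature.MathematicalPhysics.QuantumFieldTheory.Balaban1983to89.BlockAveragingEMLHaarAC (fibreFamily offCard)
open Literature.MathematicalPhysics.QuantumFieldTheory.Balaban1983to89.ExpMeanLog (expMeanLogSU deltaSU deltaSU_pos measurable_expMeanLogSU_E)
open Literature.MathematicalPhysics.QuantumFieldTheory.Balaban1983to89.Node00 (SU)
open Summit.QuantumFields.YangMills.BalabanUVNodes.N09CentralWindowAtRecord (avgFun_update_centralBond_injOn_centralWindow mem_injWindow_of_mem_centralWindow)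
open Summit.QuantumFields.YangMills.BalabanUVNodes.N09CentralWindowForwardLaw (isClosed_centralWindowW)
open Summit.QuantumFields.YangMills.BalabanUVNodes.N09CentralWindowForwardLawAtRecord (exists_jacobian_forwardLaws_continuousOn)
open Summit.QuantumFields.YangMills.BalabanUVNodes.N07AveragingLocalContinuity (continuousAt_avgFun_apply_of_small)
open Summit.QuantumFields.YangMills.BalabanUVNodes.N09CentralWindowInverseContinuous (isClosed_centralWindow)
open Literature.Topology.ParametricInverse (continuousOn_of_isClosed_graph)

variable {P : Params}

/-! ## §0h CHART-REG (fibre direction) II: the fibred chart of `Ū⁽ⁿ⁾` with its closed image windows exposed (fibre-direction continuity). -/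

section ChainChartsReg

variable {N : ℕ} [NeZero N]

open Filter Topology

/-- ★★★ **CHART-ALG III + CHART-REG** — the same chart with its image windows. [cite: Balaban1987RG1, (0.4) p.253, (2.4) p.266 and (2.10) p.267] -/
theorem exists_fibredChart_iter_reg {α : ℝ} (hα0 : 0 ≤ α) (hα24 : α ≤ 1 / 24) (hα64 : 64 * α ≤ deltaSU (Fin N))
    (hαL : 157 * α < ((P.L : ℝ) ^ (P.d - 1))⁻¹)
    (hgap : ∀ j (c : PBond P (j + 1)), (offCard c : ℝ) / (Fintype.card (Idx P) : ℝ) + 150 * α < 1)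
    {j₀ : ℝ≥0} (hvol : j₀ = 0 ∨ ChainVol P N α j₀) {n : ℕ} (hn : n ≤ P.m + P.K) :
    ∃ (Φ : GaugeField P n (SU N) × GaugeField P 0 (SU N) → GaugeField P 0 (SU N)) (Jac : GaugeField P n (SU N) × GaugeField P 0 (SU N) → ℝ≥0)
      (T : PBond P n → GaugeField P 0 (SU N) → Set (SU N)),
      Measurable Φ ∧ Measurable Jac ∧
      (∀ V z, Jac (V, z) ≠ 0 → Averaging.iter (fun i => BlockAveraging.blockAvg (P := P) (j := i) (expMeanLogSU (n := Fin N))) n (Φ (V, z)) = V) ∧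
      (∀ U₀ : Set (GaugeField P n (SU N)), MeasurableSet U₀ →
        (fieldMeasure P 0 (SU N)).restrict
            (Averaging.iter (fun i => BlockAveraging.blockAvg (P := P) (j := i) (expMeanLogSU (n := Fin N))) n ⁻¹' U₀ ∩
              {U | ∀ c, U (iterCentralBond n c) ∈ chainWindow α n U c}) =
          ((((fieldMeasure P n (SU N)).restrict U₀).prod (fieldMeasure P 0 (SU N))).withDensity fun p => (Jac p : ℝ≥0∞)).map Φ) ∧
      (∀ c z, IsClosed (T c z)) ∧
      (∀ V z, Jac (V, z) ≠ 0 ↔ ∀ c, V c ∈ T c z) ∧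
      (∀ V₀ z, (∀ c, V₀ c ∈ interior (T c z)) → ContinuousAt (fun V => Φ (V, z)) V₀ ∧ ContinuousAt (fun V => Jac (V, z)) V₀) ∧
      (∀ V₀ z, (∃ c, V₀ c ∉ closure (T c z)) → ∀ᶠ V in 𝓝 V₀, Jac (V, z) = 0) ∧
      (∀ c z, T c z = chainMap (expMeanLogSU (n := Fin N)) n z c '' chainWindow α n z c) ∧
      (∀ V z, (∀ c, V c ∈ T c z) → (∀ b, (∀ c, iterCentralBond n c ≠ b) → Φ (V, z) b = z b) ∧
        ∀ c, Φ (V, z) (iterCentralBond n c) ∈ chainWindow α n (Φ (V, z)) c) ∧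
      (∀ p, j₀ ^ (n * Fintype.card (PBond P n)) * Jac p ≤ 1) ∧
      (∀ V z (g : PBond P n → SU N), (∀ c, g c ∈ chainWindow α n z c) →
        (∀ c, V c = Averaging.iter (fun i => BlockAveraging.blockAvg (P := P) (j := i) (expMeanLogSU (n := Fin N))) n
          (extend (iterCentralBond n) g z) c) →
        Jac (V, z) ≠ 0 ∧ Φ (V, z) = extend (iterCentralBond n) g z) := by
  obtain ⟨T, ϑ, jd, hTm, hθm, hjm, hright, hlaw, hTeq, hleft, hmemW, hTc, hθc, hjc, hj0, hjlb⟩ :=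
    exists_chainCharts_lb (N := N) (P := P) hα0 hα24 hα64 hαL hgap hvol hn
  have hA := isLocal_iter_blockAvg (P := P) (expMeanLogSU (n := Fin N)) hn
  have hβ := iterCentralBond_injective (P := P) (n := n) hn
  have hAm : Measurable (Averaging.iter (fun i => BlockAveraging.blockAvg (P := P) (j := i) (expMeanLogSU (n := Fin N))) n) :=
    T4Continuum.measurable_iter _ (fun j => by rw [BlockAveraging.blockAvg_avg]; exact measurable_avgFun _ measurable_expMeanLogSU_E) n
  have hright' : ∀ c U, ∀ v ∈ T c U,
      Averaging.iter (fun i => BlockAveraging.blockAvg (P := P) (j := i) (expMeanLogSU (n := Fin N))) n (update U (iterCentralBond n c) (ϑ c U v)) c = v :=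
    fun c U v hv => hright c U v hv
  refine ⟨fun p => extend (iterCentralBond n) (fun c => ϑ c p.2 (p.1 c)) p.2,
    fun p => {p : GaugeField P n (SU N) × GaugeField P 0 (SU N) | ∀ c, p.1 c ∈ T c p.2}.indicator (fun p => ∏ c, jd c p.2 (p.1 c)) p, T,
    T4TriangularFibredChart.measurable_triChart ϑ hβ hθm, T4TriangularFibredChart.measurable_triJacobian T jd hTm hjm,
    fun V z hJ => T4TriangularFibredChart.apply_triChart_eq_of_jacobian_ne_zero T ϑ jd hA hβ hright' hJ, fun U₀ hU₀ => ?_, hTc,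
    fun V z => ?_, fun V₀ z hint => ?_, fun V₀ z hout => ?_, hTeq, fun V z hV => ?charted, fun p => ?bdd, fun V z g hg hVg => ?recog⟩
  case charted =>
    refine ⟨fun b hb => extend_apply' _ _ _ fun ⟨c, hc⟩ => hb c hc, fun c => ?_⟩
    dsimp only
    rw [hβ.extend_apply, chainWindow_extend α hn]
    exact hmemW c z _ (hV c)
  case recog =>
    have hVc : ∀ c, V c = chainMap (expMeanLogSU (n := Fin N)) n z c (g c) := fun c => by
      have hu : update (extend (iterCentralBond n) g z) (iterCentralBond n c) (g c) = extend (iterCentralBond n) g z := by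
        rw [Function.update_eq_self_iff]
        exact (hβ.extend_apply g z c).symm
      rw [hVg c, ← chainMap_extend (expMeanLogSU (n := Fin N)) hn g z c]
      simp only [chainMap, hu]
    have hlive : ∀ c, V c ∈ T c z := fun c => by
      rw [hTeq, hVc c]
      exact mem_image_of_mem _ (hg c)
    refine ⟨?_, ?_⟩
    · have hVs : (V, z) ∈ {p : GaugeField P n (SU N) × GaugeField P 0 (SU N) | ∀ c, p.1 c ∈ T c p.2} := hlive
      show {p : GaugeField P n (SU N) × GaugeField P 0 (SU N) | ∀ c, p.1 c ∈ T c p.2}.indicator (fun p => ∏ c, jd c p.2 (p.1 c)) (V, z) ≠ 0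
      rw [Set.indicator_of_mem hVs]
      exact Finset.prod_ne_zero_iff.2 fun c _ => hj0 c z _ (hlive c)
    · have hfun : (fun c => ϑ c z (V c)) = g := funext fun c => by rw [hVc c]; exact hleft c z (g c) (hg c)
      show extend (iterCentralBond n) (fun c => ϑ c z (V c)) z = extend (iterCentralBond n) g z
      rw [hfun]
  case bdd =>
    dsimp only
    by_cases hp : p ∈ {p : GaugeField P n (SU N) × GaugeField P 0 (SU N) | ∀ c, p.1 c ∈ T c p.2}
    · rw [Set.indicator_of_mem hp]
      calc j₀ ^ (n * Fintype.card (PBond P n)) * ∏ c, jd c p.2 (p.1 c) = ∏ c, j₀ ^ n * jd c p.2 (p.1 c) := by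
            rw [Finset.prod_mul_distrib, Finset.prod_const, Finset.card_univ, ← pow_mul]
        _ ≤ ∏ _c : PBond P n, (1 : ℝ≥0) := Finset.prod_le_prod' fun c _ => hjlb c p.2 _ (hp c)
        _ = 1 := Finset.prod_const_one
    · rw [Set.indicator_of_notMem hp, mul_zero]
      exact zero_le_one
  · exact T4TriangularFibredChart.pi_restrict_preimage_inter_eq_map_prod_withDensity (fun c U => chainWindow α n U c) T ϑ jd
      (HaarData.haar : Measure (SU N)) (HaarData.haar : Measure (SU N)) hA hβ hAm (measurableSet_chainWindow₂ α n) hTm hθm hjm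
      (fun c U g => chainWindow_extend α hn g U c) hright' hlaw hU₀
  · -- `Jac ≠ 0 ↔ all coordinates in the windows`
    dsimp only
    constructor
    · intro h
      by_contra hV
      have hVs : (V, z) ∉ {p : GaugeField P n (SU N) × GaugeField P 0 (SU N) | ∀ c, p.1 c ∈ T c p.2} := hV
      exact h (Set.indicator_of_notMem hVs _)
    · intro hV
      have hVs : (V, z) ∈ {p : GaugeField P n (SU N) × GaugeField P 0 (SU N) | ∀ c, p.1 c ∈ T c p.2} := hV
      rw [Set.indicator_of_mem hVs]
      exact Finset.prod_ne_zero_iff.2 fun c _ => hj0 c z _ (hV c)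
  · -- continuity at an all-interior coarse point
    have hθat : ∀ c, ContinuousAt (fun V : GaugeField P n (SU N) => ϑ c z (V c)) V₀ := fun c =>
      ContinuousAt.comp (f := fun V : GaugeField P n (SU N) => V c) (x := V₀)
        ((hθc c z).continuousAt (mem_interior_iff_mem_nhds.1 (hint c))) (continuous_apply c).continuousAt
    refine ⟨continuousAt_pi.2 fun b => ?_, ?_⟩
    · by_cases hb : ∃ c, iterCentralBond n c = b
      · obtain ⟨c, rfl⟩ := hb
        have h1 : (fun V : GaugeField P n (SU N) => extend (iterCentralBond n) (fun c => ϑ c z (V c)) z (iterCentralBond n c)) =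
            fun V => ϑ c z (V c) := funext fun V => hβ.extend_apply _ _ _
        rw [h1]
        exact hθat c
      · have h1 : (fun V : GaugeField P n (SU N) => extend (iterCentralBond n) (fun c => ϑ c z (V c)) z b) = fun _ => z b :=
          funext fun V => extend_apply' _ _ _ hb
        rw [h1]
        exact continuousAt_const
    · have hev : ∀ᶠ V in 𝓝 V₀, ∀ c, V c ∈ T c z :=
        Filter.eventually_all.2 fun c => (continuous_apply c).continuousAt.preimage_mem_nhds (mem_interior_iff_mem_nhds.1 (hint c))
      have hprod : ContinuousOn (fun V : GaugeField P n (SU N) => ∏ c, jd c z (V c)) {V | ∀ c, V c ∈ T c z} :=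
        continuousOn_finsetProd _ fun c _ => (hjc c z).comp (continuous_apply c).continuousOn fun V hV => hV c
      have hat : ContinuousAt (fun V : GaugeField P n (SU N) => ∏ c, jd c z (V c)) V₀ :=
        hprod.continuousAt (Filter.eventually_all.2 fun c =>
          (continuous_apply c).continuousAt.preimage_mem_nhds (mem_interior_iff_mem_nhds.1 (hint c)))
      refine hat.congr ?_
      filter_upwards [hev] with V hV
      have hVs : (V, z) ∈ {p : GaugeField P n (SU N) × GaugeField P 0 (SU N) | ∀ c, p.1 c ∈ T c p.2} := hV
      exact (Set.indicator_of_mem hVs (fun p : GaugeField P n (SU N) × GaugeField P 0 (SU N) => ∏ c, jd c p.2 (p.1 c))).symm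
  · -- death near a coarse point with a coordinate outside the closure of its window
    obtain ⟨c, hc⟩ := hout
    have hev : ∀ᶠ V in 𝓝 V₀, V c ∉ closure (T c z) :=
      (continuous_apply c).continuousAt.preimage_mem_nhds (isClosed_closure.isOpen_compl.mem_nhds hc)
    filter_upwards [hev] with V hV
    have hVs : (V, z) ∉ {p : GaugeField P n (SU N) × GaugeField P 0 (SU N) | ∀ c, p.1 c ∈ T c p.2} :=
      fun h => hV (subset_closure ((show ∀ c, V c ∈ T c z from h) c))
    exact Set.indicator_of_notMem hVs _

end ChainChartsReg

end ChainLawSec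

end Summit.QuantumFields.YangMills.Theorems.FluctuationComparisonRegPrIntLWregFibredChart

end
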